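import Summits.BirchSwinnertonDyer.Rank1Residual.Additive.SignedTwistRoot
import Summits.BirchSwinnertonDyer.Rank1Residual.AdditivePotMult.TwistTransportLocal
import Summits.BirchSwinnertonDyer.Rank1Residual.AdditivePotMult.VariableChangeSelmerOver
import HarnessLib

/-!
# (P5-1b) The η-keyed transports of the signed-`η` twist dictionary: `Θ : W[p^∞] ≃+ V[p^∞]`,
# `Θ_*` on `H¹(H, ·)` for `H ≤ Gal(ℚ̄/K₀)`, `Ψ : W(ℚ̄_E) ≃+ V(ℚ̄_E)` at an embedding, and their
# sign rules `Θ(g • m) = η(g) · g • Θ m` ((D1) of `cells/n1011/skel/T-O7ss-P5.md`)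
(cell `b2b-bsdres`, team n1011, seat n1011-p17 GEN 7; row T-O7ss-P13 follow-up (P5), file P5-1b;
design (A) APPROVED by referee-1 GEN 22)

HONEST FRAMING (cell `b2b-bsdres`, run/shared/lean/b2b/bsd-rank1-residual/, verbatim in every
file): the goal of the cell is to DELETE the COMBINATION-SHAPED residual classes of the
Birch–Swinnerton-Dyer formula for ALL analytic-rank `≤ 1` elliptic curves over `ℚ` — "full BSD
formula for every rank `≤ 1` curve in class `C`" assembled STRICTLY from published theorems — so
that the rank-`≤ 1` remainder becomes exactly the CONSTRUCTION-SHAPED classes, which are TYPED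
(missing-input `Prop`s), NOT attempted. This is not "finishing BSD". Research route on
O7-ss ∩ (G)∧ss ∩ e = 2 (OPEN) / X4 CONSTRUCTION-SHAPED; nothing here is booked; no label moves.
TOOL THEOREMS ONLY: no definition, no named Literature fact, no `sorry`; axioms standard.
(The three `abbrev`s are transparent composites of landed isomorphisms — additive-p1/p2's
`twistPrimaryEquiv`, `twistLocalEquiv`, Literature `primaryIso`, `twistLocalIso`, `h1Equiv`.)

## What is proved (frame: `W/ℚ`, `K₀ ∋ θ`, `θ² = c`, `V = C • W^{(c)}`, `t = rootInClosure K₀ θ`)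

* §1 `twistGeomEquiv_smul_of_smul_root_eq[_neg]`, `twistPrimaryEquiv_smul_of_smul_root_eq[_neg]`
  (additive-p1's sign rules keyed on `t` instead of `galRange K`, so without `[K : ℚ] = 2`);
  `geomTransport` (`Θ`, p05's composite) with `geomTransport_smul_of_smul_root_eq[_neg]`,
  `_of_mem`, `_of_le`, and **`geomTransport_smul_eta`**: `Θ (g • m) = η(g) · g • Θ m`, all `g ∈ Γ_ℚ`;
* §2 `h1Equiv_conjH1_of_smul` (the `+` twin of the tree's `h1Equiv_conjH1_neg`), `h1Transport`
  (`Θ_*`) and **`h1Transport_conjH1`**: `Θ_* (σ_* s) = η(σ) · σ_* Θ_* s`;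
* §3 `localTransport` (`Ψ`) with `localTransport_smul_of_smul_root_eq[_neg]`, `_of_mem`,
  **`localTransport_smul`**: `Ψ (τ • P) = η(res τ) · τ • Ψ P` for all `τ ∈ Γ_E`, and the local
  square `pointsMap_geomTransport`: `pointsMap_V ∘ Θ = Ψ_{closureEmb E} ∘ pointsMap_W`.

References: J. Silverman, *AEC* X.5 Cor. 5.4 [SilvermanAEC2009]; T. Dokchitser (2013) §4
[Dokchitser2013ParityNotes]; S. Kobayashi (2003) §2, §4 [Kobayashi2003].
-/

noncomputable section

open scoped Classical

open WeierstrassCurve Field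

namespace Summit.BirchSwinnertonDyer.Rank1Residual.Additive.SignedTwist

open Literature.NumberTheory.EllipticCurves Literature.NumberTheory.GaloisRepresentations
  Summit.BirchSwinnertonDyer.Rank1Residual.AdditivePotMult

/-! ## §1 Over `ℚ̄`: the η-keyed sign rule of the twist substitution and `Θ : W[p^∞] ≃+ V[p^∞]` -/

section Geom

variable (W : WeierstrassCurve ℚ) (K₀ : Type) [Field K₀] [NumberField K₀] {θ : K₀} {c : ℚ}
  (hθ : θ ∉ Set.range (algebraMap ℚ K₀)) (hc : θ ^ 2 = algebraMap ℚ K₀ c)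

/-- `Φ (g • P) = g • Φ P` for every `g ∈ Γ_ℚ` FIXING `t` (additive-p1's `twistGeomEquiv_smul_of_mem`
keyed on `t` instead of `galRange K`; no `[K : ℚ] = 2`). [cite: SilvermanAEC2009, X.5 Cor. 5.4] -/
theorem twistGeomEquiv_smul_of_smul_root_eq {g : absoluteGaloisGroup ℚ}
    (hg : g • rootInClosure K₀ θ = rootInClosure K₀ θ) (P : geomPoints (W.quadraticTwist c)) :
    twistGeomEquiv W K₀ hθ hc (g • P) = g • twistGeomEquiv W K₀ hθ hc P := by
  change twistPointEquivOver W (rootInClosure_not_mem K₀ hθ) (rootInClosure_sq K₀ hc)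
      (Affine.Point.map ((show AlgebraicClosure ℚ ≃ₐ[ℚ] AlgebraicClosure ℚ from g) :
        AlgebraicClosure ℚ →ₐ[ℚ] AlgebraicClosure ℚ) P) =
    Affine.Point.map ((show AlgebraicClosure ℚ ≃ₐ[ℚ] AlgebraicClosure ℚ from g) :
        AlgebraicClosure ℚ →ₐ[ℚ] AlgebraicClosure ℚ)
      (twistPointEquivOver W (rootInClosure_not_mem K₀ hθ) (rootInClosure_sq K₀ hc) P)
  rw [map_twistPointEquivOver W (rootInClosure_not_mem K₀ hθ) (rootInClosure_sq K₀ hc)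
    (rootInClosure_not_mem K₀ hθ) (rootInClosure_sq K₀ hc) _ hg]
  rfl

/-- `Φ (g • P) = −(g • Φ P)` for every `g ∈ Γ_ℚ` with `g t = −t`: the Galois module of `E^{(c)}`
is that of `E` twisted by the quadratic character of `t`. [cite: Dokchitser2013ParityNotes, §4] -/
theorem twistGeomEquiv_smul_of_smul_root_eq_neg {g : absoluteGaloisGroup ℚ}
    (hg : g • rootInClosure K₀ θ = -rootInClosure K₀ θ) (P : geomPoints (W.quadraticTwist c)) :
    twistGeomEquiv W K₀ hθ hc (g • P) = -(g • twistGeomEquiv W K₀ hθ hc P) := by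
  change twistPointEquivOver W (rootInClosure_not_mem K₀ hθ) (rootInClosure_sq K₀ hc)
      (Affine.Point.map ((show AlgebraicClosure ℚ ≃ₐ[ℚ] AlgebraicClosure ℚ from g) :
        AlgebraicClosure ℚ →ₐ[ℚ] AlgebraicClosure ℚ) P) =
    -Affine.Point.map ((show AlgebraicClosure ℚ ≃ₐ[ℚ] AlgebraicClosure ℚ from g) :
        AlgebraicClosure ℚ →ₐ[ℚ] AlgebraicClosure ℚ)
      (twistPointEquivOver W (rootInClosure_not_mem K₀ hθ) (rootInClosure_sq K₀ hc) P)
  rw [map_twistPointEquivOver_of_neg W (rootInClosure_not_mem K₀ hθ) (rootInClosure_sq K₀ hc)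
    (rootInClosure_not_mem K₀ hθ) (rootInClosure_sq K₀ hc) _ hg, neg_neg]
  rfl

variable (p : ℕ)

/-- `t`-keyed equivariance of `E^{(c)}[p^∞] ≃+ E[p^∞]`. [folklore] -/
theorem twistPrimaryEquiv_smul_of_smul_root_eq {g : absoluteGaloisGroup ℚ}
    (hg : g • rootInClosure K₀ θ = rootInClosure K₀ θ)
    (m : geomPrimaryTorsion (W.quadraticTwist c) p) :
    twistPrimaryEquiv W K₀ hθ hc p (g • m) = g • twistPrimaryEquiv W K₀ hθ hc p m :=
  Subtype.ext (by
    rw [coe_twistPrimaryEquiv, primaryComponent.coe_smul, primaryComponent.coe_smul,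
      coe_twistPrimaryEquiv, twistGeomEquiv_smul_of_smul_root_eq W K₀ hθ hc hg])

/-- `t`-keyed anti-equivariance of `E^{(c)}[p^∞] ≃+ E[p^∞]`. [cite: Dokchitser2013ParityNotes, §4] -/
theorem twistPrimaryEquiv_smul_of_smul_root_eq_neg {g : absoluteGaloisGroup ℚ}
    (hg : g • rootInClosure K₀ θ = -rootInClosure K₀ θ)
    (m : geomPrimaryTorsion (W.quadraticTwist c) p) :
    twistPrimaryEquiv W K₀ hθ hc p (g • m) = -(g • twistPrimaryEquiv W K₀ hθ hc p m) :=
  Subtype.ext (by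
    rw [coe_twistPrimaryEquiv, primaryComponent.coe_smul, NegMemClass.coe_neg,
      primaryComponent.coe_smul, coe_twistPrimaryEquiv,
      twistGeomEquiv_smul_of_smul_root_eq_neg W K₀ hθ hc hg])

variable {V : WeierstrassCurve ℚ} {C : VariableChange ℚ} (hCV : C • W.quadraticTwist c = V)

/-- **The geometric transport `Θ : W[p^∞] ≃+ V[p^∞]`** for `V = C • W^{(c)}`: untwist over
`ℚ̄ ∋ t = √c` then change variables (p05's `geomTransport` with `(V, K, hC) := (W, K₀, hCV)`).
[cite: SilvermanAEC2009, X.5 Cor. 5.4] -/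
abbrev geomTransport : W.geomPrimaryTorsion p ≃+ V.geomPrimaryTorsion p :=
  (twistPrimaryEquiv W K₀ hθ hc p).symm.trans (primaryIso p hCV)

/-- `Θ (g • m) = g • Θ m` when `g t = t`. [cite: SilvermanAEC2009, X.5 Cor. 5.4] -/
theorem geomTransport_smul_of_smul_root_eq {g : absoluteGaloisGroup ℚ}
    (hg : g • rootInClosure K₀ θ = rootInClosure K₀ θ) (m : W.geomPrimaryTorsion p) :
    geomTransport W K₀ hθ hc p hCV (g • m) = g • geomTransport W K₀ hθ hc p hCV m := by
  change ((twistPrimaryEquiv W K₀ hθ hc p).symm.trans (primaryIso p hCV)) (g • m) =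
    g • ((twistPrimaryEquiv W K₀ hθ hc p).symm.trans (primaryIso p hCV)) m
  rw [AddEquiv.trans_apply, AddEquiv.trans_apply, ← primaryIso_smul]
  congr 1
  apply (twistPrimaryEquiv W K₀ hθ hc p).injective
  rw [AddEquiv.apply_symm_apply, twistPrimaryEquiv_smul_of_smul_root_eq W K₀ hθ hc p hg,
    AddEquiv.apply_symm_apply]

/-- `Θ (g • m) = −(g • Θ m)` when `g t = −t`. [cite: Dokchitser2013ParityNotes, §4] -/
theorem geomTransport_smul_of_smul_root_eq_neg {g : absoluteGaloisGroup ℚ}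
    (hg : g • rootInClosure K₀ θ = -rootInClosure K₀ θ) (m : W.geomPrimaryTorsion p) :
    geomTransport W K₀ hθ hc p hCV (g • m) = -(g • geomTransport W K₀ hθ hc p hCV m) := by
  change ((twistPrimaryEquiv W K₀ hθ hc p).symm.trans (primaryIso p hCV)) (g • m) =
    -(g • ((twistPrimaryEquiv W K₀ hθ hc p).symm.trans (primaryIso p hCV)) m)
  rw [AddEquiv.trans_apply, AddEquiv.trans_apply, ← primaryIso_smul, ← map_neg]
  congr 1
  apply (twistPrimaryEquiv W K₀ hθ hc p).injective
  rw [AddEquiv.apply_symm_apply, map_neg, twistPrimaryEquiv_smul_of_smul_root_eq_neg W K₀ hθ hc p hg,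
    AddEquiv.apply_symm_apply, neg_neg]

/-- `Θ` is `Gal(ℚ̄/K₀)`-equivariant (`θ ∈ K₀`, so `galRange K₀` fixes `t`; p05's
`TameDescent.geomTransport_smul_of_mem`). [folklore] -/
theorem geomTransport_smul_of_mem {g : absoluteGaloisGroup ℚ} (hg : g ∈ galRange (K := ℚ) K₀)
    (m : W.geomPrimaryTorsion p) :
    geomTransport W K₀ hθ hc p hCV (g • m) = g • geomTransport W K₀ hθ hc p hCV m :=
  geomTransport_smul_of_smul_root_eq W K₀ hθ hc p hCV (apply_rootInClosure_of_mem K₀ hg) m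

/-- `Θ` is `H`-equivariant for `H ≤ Gal(ℚ̄/K₀)`. [folklore] -/
theorem geomTransport_smul_of_le {H : Subgroup (absoluteGaloisGroup ℚ)}
    (hH : H ≤ galRange (K := ℚ) K₀) (h : H) (m : W.geomPrimaryTorsion p) :
    geomTransport W K₀ hθ hc p hCV (h • m) = h • geomTransport W K₀ hθ hc p hCV m :=
  geomTransport_smul_of_mem W K₀ hθ hc p hCV (hH h.2) m

variable (η : absoluteGaloisGroup ℚ →* ℤˣ)
  (hη : ∀ σ : absoluteGaloisGroup ℚ, η σ = 1 ↔ σ • rootInClosure K₀ θ = rootInClosure K₀ θ)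

include hη in
/-- **The η-sign rule of `Θ`**: `Θ (g • m) = η(g) · g • Θ m` for EVERY `g ∈ Γ_ℚ` — `W[p^∞]` is
`V[p^∞] ⊗ η` as a `Γ_ℚ`-module. [cite: Dokchitser2013ParityNotes, §4] -/
theorem geomTransport_smul_eta (g : absoluteGaloisGroup ℚ) (m : W.geomPrimaryTorsion p) :
    geomTransport W K₀ hθ hc p hCV (g • m) =
      ((η g : ℤˣ) : ℤ) • g • geomTransport W K₀ hθ hc p hCV m := by
  rcases smul_rootInClosure_eq_or K₀ hc g with h | h
  · rw [geomTransport_smul_of_smul_root_eq W K₀ hθ hc p hCV h, (hη g).mpr h, Units.val_one,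
      one_zsmul]
  · rw [geomTransport_smul_of_smul_root_eq_neg W K₀ hθ hc p hCV h,
      (eta_eq_neg_one_iff K₀ hθ hc η hη g).mpr h, Units.val_neg, Units.val_one, neg_one_zsmul]

end Geom

/-! ## §2 On `H¹(H, ·)` for `H ≤ Gal(ℚ̄/K₀)`: `Θ_*` and its η-sign rule under conjugation -/

section H1Generic

universe u

variable {G : Type u} [Group G] [TopologicalSpace G] [IsTopologicalGroup G]
  {N : Subgroup G} [N.Normal]
  {M : Type u} [AddCommGroup M] [DistribMulAction G M] [TopologicalSpace M] [DiscreteTopology M]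
  {M' : Type u} [AddCommGroup M'] [DistribMulAction G M'] [TopologicalSpace M']
  [DiscreteTopology M']

/-- **Equivariance at `c` commutes with `c_*`**: for `ψ : M' ≃ M` additive, `N`-equivariant and
equivariant at `c` (`ψ (c • m') = c • ψ m'`), `ψ_* (c_* ξ') = c_* (ψ_* ξ')` on `H¹(N, ·)` (the
`+` twin of the tree's `h1Equiv_conjH1_neg`). [folklore] -/
theorem h1Equiv_conjH1_of_smul (ψ : M' ≃+ M) (hψ : ∀ (n : N) (m' : M'), ψ (n • m') = n • ψ m')
    {c : G} (hψc : ∀ m' : M', ψ (c • m') = c • ψ m') (ξ' : subgroupH1 N M') :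
    h1Equiv ψ hψ (conjH1 N M' c ξ') = conjH1 N M c (h1Equiv ψ hψ ξ') := by
  obtain ⟨f, rfl⟩ := oneCocycleClass_surjective _ ξ'
  rw [conjH1_oneCocycleClass, h1Equiv_apply, h1Equiv_apply, resH1Hom_id_oneCocycleClass,
    resH1Hom_id_oneCocycleClass, conjH1_oneCocycleClass]
  congr 1
  apply Subtype.ext
  ext n
  rw [contOneCocycles.push_apply, conjCocycle_apply]
  change ψ (c • f.1 (subgroupConj N c n)) =
    (conjCocycle N c (contOneCocycles.push (ψ : M' →+ M) hψ f)).1 n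
  rw [conjCocycle_apply, contOneCocycles.push_apply, hψc]
  rfl

end H1Generic

section H1

variable (W : WeierstrassCurve ℚ) (K₀ : Type) [Field K₀] [NumberField K₀] {θ : K₀} {c : ℚ}
  (hθ : θ ∉ Set.range (algebraMap ℚ K₀)) (hc : θ ^ 2 = algebraMap ℚ K₀ c) (p : ℕ)
  {V : WeierstrassCurve ℚ} {C : VariableChange ℚ} (hCV : C • W.quadraticTwist c = V)
  (η : absoluteGaloisGroup ℚ →* ℤˣ)
  (hη : ∀ σ : absoluteGaloisGroup ℚ, η σ = 1 ↔ σ • rootInClosure K₀ θ = rootInClosure K₀ θ)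

/-- **`Θ_* : H¹(H, W[p^∞]) ≃+ H¹(H, V[p^∞])`** for `H ≤ Gal(ℚ̄/K₀)` (the tree's `h1Equiv` of the
`H`-equivariant `Θ`). [cite: Dokchitser2013ParityNotes, §4] -/
abbrev h1Transport (H : Subgroup (absoluteGaloisGroup ℚ)) (hH : H ≤ galRange (K := ℚ) K₀) :
    W.subgroupH1 p H ≃+ V.subgroupH1 p H :=
  h1Equiv (G := H) (geomTransport W K₀ hθ hc p hCV) (geomTransport_smul_of_le W K₀ hθ hc p hCV hH)

include hη in
/-- **The η-sign rule on cohomology**: `Θ_* (σ_* s) = η(σ) · σ_* (Θ_* s)` for every `σ ∈ Γ_ℚ`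
(`H` normal). [cite: Dokchitser2013ParityNotes, §4] -/
theorem h1Transport_conjH1 (H : Subgroup (absoluteGaloisGroup ℚ)) [H.Normal]
    (hH : H ≤ galRange (K := ℚ) K₀) (σ : absoluteGaloisGroup ℚ) (s : W.subgroupH1 p H) :
    h1Transport W K₀ hθ hc p hCV H hH (W.conjH1 p H σ s) =
      ((η σ : ℤˣ) : ℤ) • V.conjH1 p H σ (h1Transport W K₀ hθ hc p hCV H hH s) := by
  rcases smul_rootInClosure_eq_or K₀ hc σ with h | h
  · rw [(hη σ).mpr h, Units.val_one, one_zsmul]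
    exact h1Equiv_conjH1_of_smul (N := H) _ _
      (fun m ↦ geomTransport_smul_of_smul_root_eq W K₀ hθ hc p hCV h m) s
  · rw [(eta_eq_neg_one_iff K₀ hθ hc η hη σ).mpr h, Units.val_neg, Units.val_one, neg_one_zsmul]
    exact h1Equiv_conjH1_neg (N := H) _ _
      (fun m ↦ geomTransport_smul_of_smul_root_eq_neg W K₀ hθ hc p hCV h m) s

end H1

/-! ## §3 At a `ℚ`-field `E` with an embedding `ι : ℚ̄ → ℚ̄_E`: `Ψ : W(ℚ̄_E) ≃+ V(ℚ̄_E)` -/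

section Local

variable (W : WeierstrassCurve ℚ) (K₀ : Type) [Field K₀] [NumberField K₀] {θ : K₀} {c : ℚ}
  (hθ : θ ∉ Set.range (algebraMap ℚ K₀)) (hc : θ ^ 2 = algebraMap ℚ K₀ c) (p : ℕ)
  {V : WeierstrassCurve ℚ} {C : VariableChange ℚ} (hCV : C • W.quadraticTwist c = V)
  (E : Type) [Field E] [Algebra ℚ E] (ι : AlgebraicClosure ℚ →ₐ[ℚ] AlgebraicClosure E)

/-- An element `τ ∈ Γ_E` acts on `ι t` as its restriction `res_ι τ ∈ Γ_ℚ` acts on `t`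
(`ι ∘ res_ι τ = τ ∘ ι`). [folklore] -/
theorem restrictScalars_apply_map_rootInClosure (τ : absoluteGaloisGroup E) :
    ((AlgEquiv.restrictScalars ℚ
        (show AlgebraicClosure E ≃ₐ[E] AlgebraicClosure E from τ) :
          AlgebraicClosure E ≃ₐ[ℚ] AlgebraicClosure E) :
        AlgebraicClosure E →ₐ[ℚ] AlgebraicClosure E) (ι (rootInClosure K₀ θ)) =
      ι (resGalOfEmb ι τ • rootInClosure K₀ θ) := by
  rw [resGalOfEmb_apply]
  exact (apply_resGalAuxOfEmb_apply ι τ (rootInClosure K₀ θ)).symm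

/-- `Φ_E (τ • Q) = τ • Φ_E Q` when `res_ι τ` fixes `t`. [folklore] -/
theorem twistLocalEquiv_smul_of_smul_root_eq {τ : absoluteGaloisGroup E}
    (hτ : resGalOfEmb ι τ • rootInClosure K₀ θ = rootInClosure K₀ θ)
    (Q : localPoints (W.quadraticTwist c) E) :
    twistLocalEquiv W K₀ hθ hc ι (τ • Q) = τ • twistLocalEquiv W K₀ hθ hc ι Q := by
  rw [localPoints.smul_def, localPoints.smul_def]
  exact (map_twistPointEquivAlg W (map_rootInClosure_not_mem K₀ hθ ι) (map_rootInClosure_sq K₀ hc ι)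
    (map_rootInClosure_not_mem K₀ hθ ι) (map_rootInClosure_sq K₀ hc ι) _
    (by rw [restrictScalars_apply_map_rootInClosure, hτ]) Q).symm

/-- `Φ_E (τ • Q) = −(τ • Φ_E Q)` when `res_ι τ` negates `t`. [cite: Dokchitser2013ParityNotes, §4] -/
theorem twistLocalEquiv_smul_of_smul_root_eq_neg {τ : absoluteGaloisGroup E}
    (hτ : resGalOfEmb ι τ • rootInClosure K₀ θ = -rootInClosure K₀ θ)
    (Q : localPoints (W.quadraticTwist c) E) :
    twistLocalEquiv W K₀ hθ hc ι (τ • Q) = -(τ • twistLocalEquiv W K₀ hθ hc ι Q) := by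
  rw [localPoints.smul_def, localPoints.smul_def]
  have h := map_twistPointEquivAlg_of_neg W (map_rootInClosure_not_mem K₀ hθ ι)
    (map_rootInClosure_sq K₀ hc ι) (map_rootInClosure_not_mem K₀ hθ ι) (map_rootInClosure_sq K₀ hc ι)
    _ (by rw [restrictScalars_apply_map_rootInClosure, hτ, map_neg]) Q
  rw [← neg_eq_iff_eq_neg] at h
  exact h.symm

/-- **The local transport `Ψ : W(ℚ̄_E) ≃+ V(ℚ̄_E)`** at the embedding `ι`: untwist at `ι t`, then
change variables. [cite: SilvermanAEC2009, X.5 Cor. 5.4] -/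
abbrev localTransport : localPoints W E ≃+ localPoints V E :=
  (twistLocalEquiv W K₀ hθ hc ι).symm.trans (twistLocalIso E hCV)

/-- `Ψ (τ • P) = τ • Ψ P` when `res_ι τ` fixes `t`. [folklore] -/
theorem localTransport_smul_of_smul_root_eq {τ : absoluteGaloisGroup E}
    (hτ : resGalOfEmb ι τ • rootInClosure K₀ θ = rootInClosure K₀ θ) (P : localPoints W E) :
    localTransport W K₀ hθ hc hCV E ι (τ • P) = τ • localTransport W K₀ hθ hc hCV E ι P := by
  change ((twistLocalEquiv W K₀ hθ hc ι).symm.trans (twistLocalIso E hCV)) (τ • P) =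
    τ • ((twistLocalEquiv W K₀ hθ hc ι).symm.trans (twistLocalIso E hCV)) P
  rw [AddEquiv.trans_apply, AddEquiv.trans_apply, ← twistLocalIso_smul]
  congr 1
  apply (twistLocalEquiv W K₀ hθ hc ι).injective
  rw [AddEquiv.apply_symm_apply, twistLocalEquiv_smul_of_smul_root_eq W K₀ hθ hc E ι hτ,
    AddEquiv.apply_symm_apply]

/-- `Ψ (τ • P) = −(τ • Ψ P)` when `res_ι τ` negates `t`. [cite: Dokchitser2013ParityNotes, §4] -/
theorem localTransport_smul_of_smul_root_eq_neg {τ : absoluteGaloisGroup E}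
    (hτ : resGalOfEmb ι τ • rootInClosure K₀ θ = -rootInClosure K₀ θ) (P : localPoints W E) :
    localTransport W K₀ hθ hc hCV E ι (τ • P) = -(τ • localTransport W K₀ hθ hc hCV E ι P) := by
  change ((twistLocalEquiv W K₀ hθ hc ι).symm.trans (twistLocalIso E hCV)) (τ • P) =
    -(τ • ((twistLocalEquiv W K₀ hθ hc ι).symm.trans (twistLocalIso E hCV)) P)
  rw [AddEquiv.trans_apply, AddEquiv.trans_apply, ← twistLocalIso_smul, ← map_neg]
  congr 1
  apply (twistLocalEquiv W K₀ hθ hc ι).injective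
  rw [AddEquiv.apply_symm_apply, map_neg, twistLocalEquiv_smul_of_smul_root_eq_neg W K₀ hθ hc E ι hτ,
    AddEquiv.apply_symm_apply, neg_neg]

/-- `Ψ` is `H_E`-equivariant for `H ≤ Gal(ℚ̄/K₀)`. [folklore] -/
theorem localTransport_smul_of_mem {H : Subgroup (absoluteGaloisGroup ℚ)}
    (hH : H ≤ galRange (K := ℚ) K₀) (τ : localSubgroupOfEmb H ι) (P : localPoints W E) :
    localTransport W K₀ hθ hc hCV E ι (τ • P) = τ • localTransport W K₀ hθ hc hCV E ι P :=
  localTransport_smul_of_smul_root_eq W K₀ hθ hc hCV E ι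
    (apply_rootInClosure_of_mem K₀ (hH ((mem_localSubgroupOfEmb_iff H ι _).mp τ.2))) P

variable (η : absoluteGaloisGroup ℚ →* ℤˣ)
  (hη : ∀ σ : absoluteGaloisGroup ℚ, η σ = 1 ↔ σ • rootInClosure K₀ θ = rootInClosure K₀ θ)

include hη in
/-- **The η-sign rule of `Ψ`**: `Ψ (τ • P) = η(res_ι τ) · τ • Ψ P` for every `τ ∈ Γ_E`.
[cite: Dokchitser2013ParityNotes, §4] -/
theorem localTransport_smul (τ : absoluteGaloisGroup E) (P : localPoints W E) :
    localTransport W K₀ hθ hc hCV E ι (τ • P) =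
      ((η (resGalOfEmb ι τ) : ℤˣ) : ℤ) • τ • localTransport W K₀ hθ hc hCV E ι P := by
  rcases smul_rootInClosure_eq_or K₀ hc (resGalOfEmb ι τ) with h | h
  · rw [localTransport_smul_of_smul_root_eq W K₀ hθ hc hCV E ι h, (hη _).mpr h, Units.val_one,
      one_zsmul]
  · rw [localTransport_smul_of_smul_root_eq_neg W K₀ hθ hc hCV E ι h,
      (eta_eq_neg_one_iff K₀ hθ hc η hη _).mpr h, Units.val_neg, Units.val_one, neg_one_zsmul]

/-- **The local square**: `pointsMap_V ∘ Θ = Ψ_{closureEmb E} ∘ pointsMap_W` on `W[p^∞]`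
(`pointsMapOfEmb_twistGeomEquiv` + `pointsMap_twistPointsIso`). [folklore] -/
theorem pointsMap_geomTransport (m : W.geomPrimaryTorsion p) :
    pointsMap V E ((geomTransport W K₀ hθ hc p hCV m : V.geomPrimaryTorsion p) : V.geomPoints) =
      localTransport W K₀ hθ hc hCV E (closureEmb (K := ℚ) E)
        (pointsMap W E ((m : W.geomPrimaryTorsion p) : W.geomPoints)) := by
  set P' := (twistPrimaryEquiv W K₀ hθ hc p).symm m with hP'
  have hm : ((m : W.geomPrimaryTorsion p) : W.geomPoints) =
      twistGeomEquiv W K₀ hθ hc (P' : geomPoints (W.quadraticTwist c)) := by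
    rw [← coe_twistPrimaryEquiv, hP', AddEquiv.apply_symm_apply]
  change pointsMap V E ((primaryIso p hCV P' : V.geomPrimaryTorsion p) : V.geomPoints) =
    twistLocalIso E hCV ((twistLocalEquiv W K₀ hθ hc (closureEmb (K := ℚ) E)).symm
      (pointsMap W E ((m : W.geomPrimaryTorsion p) : W.geomPoints)))
  rw [hm, primaryIso, coe_primaryComponentCongr, pointsMap_twistPointsIso]
  congr 1
  rw [eq_comm, AddEquiv.symm_apply_eq]
  exact pointsMapOfEmb_twistGeomEquiv W K₀ hθ hc (closureEmb (K := ℚ) E) _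

end Local

end Summit.BirchSwinnertonDyer.Rank1Residual.Additive.SignedTwist
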